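import Mathlib
import Summits.RiemannHypothesis.RiemannHypothesis.Theses.WeilGroundState
import Literature.NumberTheory.LFunctions.WeilGroundEnergyProofs
import Summits.RiemannHypothesis.RiemannHypothesis.Theorems.GronwallLeakage.Negative.LoadBearing
import Summits.RiemannHypothesis.RiemannHypothesis.Theorems.WeilGroundStateGroundStateSimpleEvenOfOddSectorGap
import HarnessLib

/-!
# Crux `GroundStateSimpleEven` (stmt-RiemannHypothesis-1526), line `parity-multiplicity-commutator`
# (v2): cell transfer — the window clause on a whole interval of windows from two certificates

Support file (`--supports stmt-RiemannHypothesis-1526`) proving the registered sub-goal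
`stub_cellTransfer` of the v2 skeleton: the actionable form of the recommended re-cut of the crux to
a bounded range of windows.

## Statement (`weilWindowSimpleEven_on_cell`)

Let `0 < b ≤ c` and suppose
* (U) one `L²`-normalised window-`b` test function `e` with `Re Q(e) ≤ U` (an UPPER bound for
  `ε(b)`), and
* (L) every `L²`-normalised ODD window-`c` test function has `Re Q ≥ L` (a certified LOWER bound for
  the odd sector at the larger window),
with `U < L`.  Then `WeilWindowSimpleEven a` holds for EVERY `a ∈ [b, c]`.

Proof: both sector bottoms are antitone in the window, so for `a ∈ [b, c]` and an odd normalised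
window-`a` test `g` (a window-`c` test): `Re Q(g) ≥ L = U + (L − U) ≥ ε(b) + (L − U) ≥ ε(a) + (L − U)`
— the odd sector is gapped at `a` with `δ = L − U`, and the halving theorem of this line
(`stub_weilWindowSimpleEven_of_oddSectorGap`: odd gap ⟹ simple, isolated, even bottom) concludes.
No continuity in `a` is needed, and — the point of the v2 line — no lower bound for the even sector
orthogonal to the ground state (the expensive half of an item-1529-style certificate).  A finite
chain of such cells `b = a₀ < a₁ < … < a_N = c` with `U_k < L_{k+1}` gives the crux on `[a₀, a_N]`.

Mathlib + proved tree files only; no definitions, no named facts, no `sorry`.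
-/

noncomputable section

open Set MeasureTheory Filter
open scoped Real Topology ComplexConjugate

namespace Summit.RiemannHypothesis.RiemannHypothesis.Theorems.GroundStateSimpleEven

open Literature.NumberTheory.LFunctions
open Summit.RiemannHypothesis.RiemannHypothesis.Theses.WeilGroundState

-- `linter.dupNamespace` off: the mandated namespace `Summit.RiemannHypothesis.RiemannHypothesis.…`
-- (single-problem summit) repeats a component.
set_option linter.dupNamespace false

/-- **One trial function bounds `ε` from above**: an `L²`-normalised window-`b` test function `e`
with `Re Q(e) ≤ U` gives `ε(b) ≤ U` (`csInf_le` with `bddBelow_weilQuadratic_sphere_holds`).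
[folklore] -/
theorem weilGroundEnergy_le_of_trial {b U : ℝ} {e : ℝ → ℂ} (he : IsWeilTest e)
    (hes : tsupport e ⊆ Icc (-b) b) (hen : ∫ t, ‖e t‖ ^ 2 = (1 : ℝ))
    (heU : (weilQuadratic e).re ≤ U) : weilGroundEnergy b ≤ U :=
  (csInf_le (bddBelow_weilQuadratic_sphere_holds b) ⟨e, he, hes, hen, rfl⟩).trans heU

/-- **Odd-sector gap on a cell from two bounds.** With `0 < b ≤ c`, an upper bound
`ε(b) ≤ U` and a lower bound `L > U` for the `L²`-normalised odd window-`c` test functions, the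
odd sector is gapped (by `L − U`) at every window `a ∈ [b, c]`: both bounds transfer by
antitonicity in the window. [folklore] -/
theorem oddSectorGap_on_cell_of_le {b c U L : ℝ} (hb : 0 < b) (hUL : U < L)
    (hU : weilGroundEnergy b ≤ U)
    (hL : ∀ g : ℝ → ℂ, IsWeilTest g → tsupport g ⊆ Icc (-c) c → ∫ t, ‖g t‖ ^ 2 = (1 : ℝ) →
      (∀ t, g (-t) = -g t) → L ≤ (weilQuadratic g).re)
    {a : ℝ} (hba : b ≤ a) (hac : a ≤ c) :
    ∃ δ : ℝ, 0 < δ ∧ ∀ g : ℝ → ℂ, IsWeilTest g → tsupport g ⊆ Icc (-a) a →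
      ∫ t, ‖g t‖ ^ 2 = (1 : ℝ) → (∀ t, g (-t) = -g t) →
        weilGroundEnergy a + δ ≤ (weilQuadratic g).re := by
  refine ⟨L - U, sub_pos.2 hUL, fun g hg hgs hgn hodd ↦ ?_⟩
  have h1 : weilGroundEnergy a ≤ weilGroundEnergy b :=
    Summit.RiemannHypothesis.Cruxes.GronwallLeakage.Negative.weilGroundEnergy_antitone_of_pos hb hba
  have h3 : L ≤ (weilQuadratic g).re :=
    hL g hg (hgs.trans (Icc_subset_Icc (by linarith) hac)) hgn hodd
  linarith

/-- **Cell transfer from two bounds.** With `0 < b ≤ c`, `ε(b) ≤ U` and a certified lower bound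
`L > U` for the `L²`-normalised ODD window-`c` test functions, `WeilWindowSimpleEven a` (simple,
isolated, even bottom) holds for every `a ∈ [b, c]` (`oddSectorGap_on_cell_of_le` and the halving
theorem `stub_weilWindowSimpleEven_of_oddSectorGap`). [folklore] -/
theorem weilWindowSimpleEven_on_cell_of_le {b c U L : ℝ} (hb : 0 < b) (hUL : U < L)
    (hU : weilGroundEnergy b ≤ U)
    (hL : ∀ g : ℝ → ℂ, IsWeilTest g → tsupport g ⊆ Icc (-c) c → ∫ t, ‖g t‖ ^ 2 = (1 : ℝ) →
      (∀ t, g (-t) = -g t) → L ≤ (weilQuadratic g).re)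
    {a : ℝ} (hba : b ≤ a) (hac : a ≤ c) : WeilWindowSimpleEven a :=
  stub_weilWindowSimpleEven_of_oddSectorGap a (hb.trans_le hba)
    (oddSectorGap_on_cell_of_le hb hUL hU hL hba hac)

/-- **Cell transfer from two certificates.** With `0 < b ≤ c`, one `L²`-normalised window-`b` test
function of energy `≤ U` and a certified lower bound `L > U` for the `L²`-normalised ODD window-`c`
test functions, `WeilWindowSimpleEven a` holds for every `a ∈ [b, c]`
(`weilGroundEnergy_le_of_trial` and `weilWindowSimpleEven_on_cell_of_le`). [folklore] -/
theorem weilWindowSimpleEven_on_cell {b c U L : ℝ} (hb : 0 < b) (hUL : U < L)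
    (hU : ∃ e : ℝ → ℂ, IsWeilTest e ∧ tsupport e ⊆ Icc (-b) b ∧ ∫ t, ‖e t‖ ^ 2 = (1 : ℝ) ∧
      (weilQuadratic e).re ≤ U)
    (hL : ∀ g : ℝ → ℂ, IsWeilTest g → tsupport g ⊆ Icc (-c) c → ∫ t, ‖g t‖ ^ 2 = (1 : ℝ) →
      (∀ t, g (-t) = -g t) → L ≤ (weilQuadratic g).re)
    {a : ℝ} (hba : b ≤ a) (hac : a ≤ c) : WeilWindowSimpleEven a := by
  obtain ⟨e, he, hes, hen, heU⟩ := hU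
  exact weilWindowSimpleEven_on_cell_of_le hb hUL (weilGroundEnergy_le_of_trial he hes hen heU) hL
    hba hac

end Summit.RiemannHypothesis.RiemannHypothesis.Theorems.GroundStateSimpleEven

namespace Summit.RiemannHypothesis.RiemannHypothesis.Theorems

open Literature.NumberTheory.LFunctions

set_option linter.dupNamespace false in
/-- **Registered sub-goal (CELL) of line `parity-multiplicity-commutator` (v2): cell transfer.**
For `0 < b ≤ c`, one `L²`-normalised window-`b` test function of energy `≤ U` and a lower bound
`L > U` for the `L²`-normalised odd window-`c` test functions give `WeilWindowSimpleEven a` for every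
`a ∈ [b, c]` (`GroundStateSimpleEven.weilWindowSimpleEven_on_cell`): the actionable form of the
recommended re-cut of the crux to a bounded range of windows. [folklore] -/
theorem stub_cellTransfer :
    ∀ b c U L : ℝ, 0 < b → U < L →
      (∃ e : ℝ → ℂ, IsWeilTest e ∧ tsupport e ⊆ Icc (-b) b ∧ ∫ t, ‖e t‖ ^ 2 = (1 : ℝ) ∧
        (weilQuadratic e).re ≤ U) →
      (∀ g : ℝ → ℂ, IsWeilTest g → tsupport g ⊆ Icc (-c) c → ∫ t, ‖g t‖ ^ 2 = (1 : ℝ) →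
        (∀ t, g (-t) = -g t) → L ≤ (weilQuadratic g).re) →
      ∀ a : ℝ, b ≤ a → a ≤ c → WeilWindowSimpleEven a :=
  fun _ _ _ _ hb hUL hU hL _ hba hac =>
    GroundStateSimpleEven.weilWindowSimpleEven_on_cell hb hUL hU hL hba hac

end Summit.RiemannHypothesis.RiemannHypothesis.Theorems

end
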